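import Summits.BirchSwinnertonDyer.Rank1Residual.X2.GreenbergVatsalCaseOneLe
import Summits.BirchSwinnertonDyer.Rank1Residual.X2.GreenbergVatsalCaseTwoPeriodFree
import HarnessLib

/-!
# Class X2a, GV CASE 2 and the flag's fact A64 at an odd multiplicative Eisenstein prime WITHOUT
# the datum record — cell `b2b-bsdres`, unit `b2b-bsdres-eisenstein-p2`, gen 30 (F7d)

HONEST FRAMING (run/shared/lean/b2b/bsd-rank1-residual/, verbatim in every file): the goal of the
cell is to DELETE the COMBINATION-SHAPED residual classes of the Birch–Swinnerton-Dyer formula for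
ALL analytic-rank `≤ 1` elliptic curves over `ℚ` — "full BSD formula for every rank `≤ 1` curve in
class `C`" assembled STRICTLY from published theorems — so that the rank-`≤ 1` remainder becomes
exactly the CONSTRUCTION-SHAPED classes, which are TYPED (missing-input `Prop`s), NOT attempted.
This is not "finishing BSD". Research route; NO CLAIM BEYOND STATED CLASSES; nothing here changes a
label. Theorems only; no definition, no named fact, no `sorry`.

WHAT. Gen 28's `GreenbergVatsalCaseTwoPeriodFree` proved CASE 2 (GV p. 28: pass to the
`p`-isogenous curve `E' = E/Φ₀`, whose line is ramified and even) and assembled A64 from CASE 1 +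
CASE 2 over the registered facts {A40, A41, A133, A135, A137, Prop. 5.10} and the typed inputs. Gen 30
removed A133/A137 (hence T-GV23L and A137′) from CASE 1 (`GreenbergVatsalCaseOneLe`, using Wuthrich
Thm. 16 for the lower half); this file carries the change through CASE 2 and the assembly:

* `caseTwo_clause_of_inputs_le` — CASE 2, proof verbatim from gen 28 with the new CASE 1;
* **`lambda_muAnal_multiplicative_of_gvPar_of_inputs_le`** — A64 from {A40 `hT`, A41 `hT'`, A135
  `hB`, Prop. 5.10 `hG`, A33 `hWu`, `hLift`, `hAn`}.

References: [GreenbergVatsal2000] Thm. (1.3), §2 (16), p. 28, §3 Cor. (3.8), Thm. (3.11);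
[Wuthrich2014] Thm. 16; [DokchitserLocalInvariants2015] Prop. 18, Thm. 2; HOME X2-GAP.md §35.
-/

set_option autoImplicit false

noncomputable section

open scoped Classical AddSubgroup MatrixGroups ModularForm

open PowerSeries NumberField IsDedekindDomain Field WeierstrassCurve CongruenceSubgroup
  Literature.NumberTheory.EllipticCurves Literature.NumberTheory.EllipticCurves.GreenbergVatsal2000
  Literature.NumberTheory.EllipticCurves.ModularForms
  Literature.NumberTheory.EllipticCurves.Rank1Residual
  Literature.NumberTheory.EllipticCurves.Rank1Residual.Typed
  Literature.NumberTheory.EllipticCurves.Greenberg1999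
  Literature.NumberTheory.EllipticCurves.Wuthrich2014
  Literature.NumberTheory.EllipticCurves.SteinWuthrich2013
  Summit.BirchSwinnertonDyer.Rank1Residual.X2.IsogenyQuotientLine
  Summit.BirchSwinnertonDyer.Rank1Residual.X2.IsogenyLineType
  Summit.BirchSwinnertonDyer.Rank1Residual.X2.IsogenyLambdaInvariant
  Summit.BirchSwinnertonDyer.Rank1Residual.X2.GreenbergVatsalAnalyticTransferCore
  Summit.BirchSwinnertonDyer.Rank1Residual.X2.GreenbergVatsalCaseTwo
  Summit.BirchSwinnertonDyer.Rank1Residual.X2.GreenbergVatsalInputsOfFacts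
  Summit.BirchSwinnertonDyer.Rank1Residual.X2.EisensteinCongruenceOfFacts
  Summit.BirchSwinnertonDyer.Rank1Residual.X2.GreenbergProp510OfFacts
  Summit.BirchSwinnertonDyer.Rank1Residual.X2.ClassClosureOfDerivedF0
  Summit.BirchSwinnertonDyer.Rank1Residual.X2.NonPrimitiveLambdaInvariantMultiplicativeDerived
  Summit.BirchSwinnertonDyer.Rank1Residual.X2.TrivialZeroStrictInclusionDerived
  Summit.BirchSwinnertonDyer.Rank1Residual.X2.GreenbergVatsalCaseTwoPeriodFree

namespace Summit.BirchSwinnertonDyer.Rank1Residual.X2.GreenbergVatsalCaseTwoLe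

/-! ## §1. CASE 2 without the datum record -/

/-- **GV CASE 2 (rational line UNRAMIFIED at `p` and ODD) of the `λ`/`μ^anal` clause at an odd
multiplicative prime WITHOUT the datum record**: gen 28's `caseTwo_clause_of_inputs_periodFree`
verbatim (quotient `E' = E/Φ₀` with its ramified-even line, the isogeny, `Ω_{E'} = u·Ω_E` with
`|u|_p = 1`, `λ(E) = λ(E')`, transport of `b`), CASE 1 for `E'` now being
`GreenbergVatsalCaseOneLe.caseOne_clause_of_inputs_le` (A133/A137 replaced by Wuthrich Thm. 16 `hWu`
and the cyclotomic-variable matching `hγ'`). [cite: GreenbergVatsal2000, §2 p. 28, §3 Cor. (3.8)]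
[cite: DokchitserLocalInvariants2015, Prop. 18 and Thm. 2] [cite: Wuthrich2014, Thm. 16 (p. 397)] -/
theorem caseTwo_clause_of_inputs_le
    (hT : Silverman1994_thmV53_tateUniformisation.{0})
    (hT' : Silverman1994_thmV53_corV54_tateUniformisation.{0})
    (hB : datumSelmer_divisible_of_finite_torsionBy)
    (hG : Greenberg1999.prop510_isTorsion_hasUnitContent_of_gvPar)
    (hWu : Wuthrich2014.thm16_charIdeal_dvd_multiplicative_of_reducible)
    (hLift : ∀ (W : WeierstrassCurve ℚ) [W.IsGloballyMinimal] [W.IsElliptic] (p : ℕ) [Fact p.Prime]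
      (κ : ZpExtension ℚ p) (S₀ : Finset (HeightOneSpectrum (𝓞 ℚ)))
      (Φ₀ : AddSubgroup (W.geomTorsion (p : ℤ))) (hΦ : IsRationalLine W p Φ₀),
      p ≠ 2 → κ.IsCyclotomic → ¬ LineUnramifiedAt W p Φ₀ → LineEven W p Φ₀ →
      (∀ v ∈ S₀, ((p : ℕ) : 𝓞 ℚ) ∉ v.asIdeal) →
      (∀ v : HeightOneSpectrum (𝓞 ℚ), v ∉ S₀ → ((p : ℕ) : 𝓞 ℚ) ∉ v.asIdeal →
        W.HasGoodReductionAt v) →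
      GVLiftingInput W p κ S₀ Φ₀ hΦ)
    (hAn : ∀ (W : WeierstrassCurve ℚ) [W.IsGloballyMinimal] [W.IsElliptic] (p : ℕ) [Fact p.Prime]
      (κ : ZpExtension ℚ p) {N : ℕ} [NeZero N] (f : CuspForm (Gamma0 N) 2)
      (S₀ : Finset (HeightOneSpectrum (𝓞 ℚ)))
      (Φ₀ : AddSubgroup (W.geomTorsion (p : ℤ))) (hΦ : IsRationalLine W p Φ₀),
      p ≠ 2 → W.HasMultiplicativeReductionAtPrime p → κ.IsCyclotomic →
      ¬ LineUnramifiedAt W p Φ₀ → LineEven W p Φ₀ → IsNewformOf W f →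
      (∀ v ∈ S₀, ((p : ℕ) : 𝓞 ℚ) ∉ v.asIdeal) →
      (∀ v : HeightOneSpectrum (𝓞 ℚ), v ∉ S₀ → ((p : ℕ) : 𝓞 ℚ) ∉ v.asIdeal →
        W.HasGoodReductionAt v) →
      GVAnalyticInput W p κ f S₀ Φ₀ hΦ)
    (W : WeierstrassCurve ℚ) [W.IsElliptic] [W.IsGloballyMinimal] (p : ℕ) [Fact p.Prime]
    {κ : ZpExtension ℚ p} {γ : absoluteGaloisGroup ℚ} {N : ℕ} [NeZero N]
    {f : CuspForm (Gamma0 N) 2}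
    (hp : p ≠ 2) (hmult : W.HasMultiplicativeReductionAtPrime p)
    {Φ₀ : AddSubgroup (W.geomTorsion (p : ℤ))} (hΦ : IsRationalLine W p Φ₀)
    (hunr : LineUnramifiedAt W p Φ₀) (hodd : LineOdd W p Φ₀)
    (hκ : κ.IsCyclotomic) (hγ : κ.IsTopGenerator γ)
    (hγ' : IsCyclotomicVariable p γ) (hf : IsNewformOf W f)
    (D : W.SelmerDualData κ γ) (ϖ : ℚ) (hϖ : (ϖ : ℝ) * W.realPeriodRat = plusPeriod f)
    (fE : IwasawaAlgebra p) (hchar : D.charIdeal = Ideal.span {fE}) :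
    (W.HasSplitMultiplicativeReductionAtPrime p →
        ∀ (L : PowerSeries ℚ_[p]), IsSplitMultPAdicLFunctionOf f p L →
        ∀ (b : IwasawaAlgebra p), iwasawaToPowerSeries p b = PowerSeries.C ((ϖ : ℚ) : ℚ_[p]) * L →
          HasUnitContent b ∧
            (PowerSeries.map (PadicInt.toZMod (p := p)) b).order =
              (PowerSeries.map (PadicInt.toZMod (p := p)) (PowerSeries.X * fE)).order) ∧
      (¬ W.HasSplitMultiplicativeReductionAtPrime p →
        ∀ (L : PowerSeries ℚ_[p]), IsMultPAdicLFunctionOf f p (-1) L →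
        ∀ (b : IwasawaAlgebra p), iwasawaToPowerSeries p b = PowerSeries.C ((ϖ : ℚ) : ℚ_[p]) * L →
          HasUnitContent b ∧
            (PowerSeries.map (PadicInt.toZMod (p := p)) b).order =
              (PowerSeries.map (PadicInt.toZMod (p := p)) fE).order) := by
  -- the quotient `E' = E/Φ₀` on a globally minimal model, with its ramified-even line
  obtain ⟨W', _, _, g, hker, -, u, hu1, hΩ⟩ :=
    IsogenyPeriodRatio.exists_quot_realPeriodRat_eq_unit_mul hp (Or.inr hmult) hΦ hunr hodd
  obtain ⟨Φ', hΦ', hram', heven'⟩ :=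
    exists_rationalLine_ramified_even_of_isogeny hT hT' hp hmult hΦ hunr hodd g hker
  have hiso : IsIsogenous W W' := ⟨g⟩
  have hmult' : W'.HasMultiplicativeReductionAtPrime p :=
    hasMultiplicativeReductionAtPrime_of_isIsogenous hiso hmult
  have hsplit_iff : W.HasSplitMultiplicativeReductionAtPrime p ↔
      W'.HasSplitMultiplicativeReductionAtPrime p :=
    hasSplitMultiplicativeReductionAtPrime_iff_of_isIsogenous hiso
  have hf' : IsNewformOf W' f := hf.of_isIsogenous hiso.symm_of_charZero
  have hgv : GVPar W p := ⟨Φ₀, hΦ, Or.inr ⟨hunr, hodd⟩⟩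
  have hgv' : GVPar W' p := ⟨Φ', hΦ', Or.inl ⟨hram', heven'⟩⟩
  -- the period: `Ω_{E'} = u · Ω_E`, `|u|_p = 1` (Cor. (3.8), DERIVED: `X2/IsogenyPeriodRatio`)
  have hu0 : (u : ℚ_[p]) ≠ 0 := fun h ↦ by simp [h] at hu1
  have hu0' : u ≠ 0 := fun h ↦ hu0 (by rw [h, Rat.cast_zero])
  set cU : ℤ_[p]ˣ := PadicInt.mkUnits hu1 with hcU
  have hcUinv : (((cU⁻¹ : ℤ_[p]ˣ) : ℤ_[p]) : ℚ_[p]) = (u : ℚ_[p])⁻¹ := by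
    apply eq_inv_of_mul_eq_one_left
    rw [← PadicInt.mkUnits_eq hu1, ← PadicInt.coe_mul, Units.inv_mul, PadicInt.coe_one]
  have hϖ' : ((ϖ / u : ℚ) : ℝ) * W'.realPeriodRat = plusPeriod f := by
    rw [hΩ, Rat.cast_div, ← hϖ, ← mul_assoc,
      div_mul_cancel₀ _ (by exact_mod_cast hu0' : (u : ℝ) ≠ 0)]
  -- a dual datum for `E'`; `μ = 0` on both sides (Prop. 5.10); `λ(E) = λ(E')` (isogeny invariance)
  obtain ⟨D'⟩ := W'.nonempty_selmerDualData_holds κ γ hγ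
  haveI := WeierstrassCurve.SelmerDualData.module_finite_of_isCyclotomic W κ hκ D hγ
  haveI := WeierstrassCurve.SelmerDualData.module_finite_of_isCyclotomic W' κ hκ D' hγ
  obtain ⟨hX, fE₀, hchar₀, huf₀⟩ := hG.of_mult W p hp hmult hgv hκ hγ D
  obtain ⟨hX', fE', hchar', huf'⟩ := hG.of_mult W' p hp hmult' hgv' hκ hγ D'
  have hμ : D.mu = 0 := (mu_eq_zero_iff_hasUnitContent D hX hchar₀).mpr huf₀
  have hμ' : D'.mu = 0 := (mu_eq_zero_iff_hasUnitContent D' hX' hchar').mpr huf'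
  have hord : (PowerSeries.map (PadicInt.toZMod (p := p)) fE).order =
      (PowerSeries.map (PadicInt.toZMod (p := p)) fE').order := by
    rw [← natCast_lambdaInvariant_eq_order_map_toZMod D hX hμ hchar,
      ← natCast_lambdaInvariant_eq_order_map_toZMod D' hX' hμ' hchar',
      lambdaInvariant_eq_of_isogeny g D D']
  -- CASE 1 for `E'`
  have hcl' := GreenbergVatsalCaseOneLe.caseOne_clause_of_inputs_le hT hT' hB hG hWu hLift hAn W' p hp
    hmult' hΦ' hram' heven' hκ hγ hγ' hf' D' (ϖ / u) hϖ' fE' hchar'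
  -- transport of `b`: `b' = C(c⁻¹)·b` has `ι b' = (ϖ/u)·L`, and `b = C(c)·b'`
  have key : ∀ (L : PowerSeries ℚ_[p]) (b : IwasawaAlgebra p),
      iwasawaToPowerSeries p b = PowerSeries.C ((ϖ : ℚ) : ℚ_[p]) * L →
      iwasawaToPowerSeries p (PowerSeries.C ((cU⁻¹ : ℤ_[p]ˣ) : ℤ_[p]) * b) =
          PowerSeries.C (((ϖ / u : ℚ)) : ℚ_[p]) * L ∧
        b = PowerSeries.C ((cU : ℤ_[p]ˣ) : ℤ_[p]) * (PowerSeries.C ((cU⁻¹ : ℤ_[p]ˣ) : ℤ_[p]) * b) := by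
    intro L b hιb
    refine ⟨?_, ?_⟩
    · rw [iwasawaToPowerSeries_C_mul, hιb, ← mul_assoc, ← map_mul, Rat.cast_div, div_eq_inv_mul,
        hcUinv]
    · rw [← mul_assoc, ← map_mul, Units.mul_inv, map_one, one_mul]
  refine ⟨fun hsplit L hL b hιb ↦ ?_, fun hns L hL b hιb ↦ ?_⟩
  · obtain ⟨hιb', hb⟩ := key L b hιb
    obtain ⟨hub', hord'⟩ := hcl'.1 (hsplit_iff.mp hsplit) L hL _ hιb'
    obtain ⟨hC1, hC2⟩ := hasUnitContent_and_order_C_mul cU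
      (PowerSeries.C ((cU⁻¹ : ℤ_[p]ˣ) : ℤ_[p]) * b)
    refine ⟨?_, ?_⟩
    · rw [hb]; exact hC1.mpr hub'
    · rw [hb, hC2, hord', map_mul, map_mul, PowerSeries.order_mul, PowerSeries.order_mul, hord]
  · obtain ⟨hιb', hb⟩ := key L b hιb
    obtain ⟨hub', hord'⟩ := hcl'.2 (fun h ↦ hns (hsplit_iff.mpr h)) L hL _ hιb'
    obtain ⟨hC1, hC2⟩ := hasUnitContent_and_order_C_mul cU
      (PowerSeries.C ((cU⁻¹ : ℤ_[p]ˣ) : ℤ_[p]) * b)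
    refine ⟨?_, ?_⟩
    · rw [hb]; exact hC1.mpr hub'
    · rw [hb, hC2, hord', hord]

/-! ## §2. A64 without the datum record -/

/-- **A64 = `GreenbergVatsal2000.lambda_muAnal_multiplicative_of_gvPar` from the CASE-1 inputs WITHOUT
the datum record**: registered facts A40/A41 (`hT`, `hT'`), A135 (`hB`), Greenberg Prop. 5.10 (`hG`),
Wuthrich Thm. 16 (`hWu`) and the two TYPED inputs at every admissible datum; CASE 1 by
`caseOne_clause_of_inputs_le`, CASE 2 by `caseTwo_clause_of_inputs_le` (the fact's own binder
`IsCyclotomicVariable p γ`, idle before, now feeds `hWu`). NOT used: A133, A137, A137′, T-GV23L.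
[cite: GreenbergVatsal2000, Thm. (1.3), §2 (16) and p. 28, §3 Thm. (3.11)] [cite: Wuthrich2014, Thm. 16 (p. 397)] -/
theorem lambda_muAnal_multiplicative_of_gvPar_of_inputs_le
    (hT : Silverman1994_thmV53_tateUniformisation.{0})
    (hT' : Silverman1994_thmV53_corV54_tateUniformisation.{0})
    (hB : datumSelmer_divisible_of_finite_torsionBy)
    (hG : Greenberg1999.prop510_isTorsion_hasUnitContent_of_gvPar)
    (hWu : Wuthrich2014.thm16_charIdeal_dvd_multiplicative_of_reducible)
    (hLift : ∀ (W : WeierstrassCurve ℚ) [W.IsGloballyMinimal] [W.IsElliptic] (p : ℕ) [Fact p.Prime]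
      (κ : ZpExtension ℚ p) (S₀ : Finset (HeightOneSpectrum (𝓞 ℚ)))
      (Φ₀ : AddSubgroup (W.geomTorsion (p : ℤ))) (hΦ : IsRationalLine W p Φ₀),
      p ≠ 2 → κ.IsCyclotomic → ¬ LineUnramifiedAt W p Φ₀ → LineEven W p Φ₀ →
      (∀ v ∈ S₀, ((p : ℕ) : 𝓞 ℚ) ∉ v.asIdeal) →
      (∀ v : HeightOneSpectrum (𝓞 ℚ), v ∉ S₀ → ((p : ℕ) : 𝓞 ℚ) ∉ v.asIdeal →
        W.HasGoodReductionAt v) →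
      GVLiftingInput W p κ S₀ Φ₀ hΦ)
    (hAn : ∀ (W : WeierstrassCurve ℚ) [W.IsGloballyMinimal] [W.IsElliptic] (p : ℕ) [Fact p.Prime]
      (κ : ZpExtension ℚ p) {N : ℕ} [NeZero N] (f : CuspForm (Gamma0 N) 2)
      (S₀ : Finset (HeightOneSpectrum (𝓞 ℚ)))
      (Φ₀ : AddSubgroup (W.geomTorsion (p : ℤ))) (hΦ : IsRationalLine W p Φ₀),
      p ≠ 2 → W.HasMultiplicativeReductionAtPrime p → κ.IsCyclotomic →
      ¬ LineUnramifiedAt W p Φ₀ → LineEven W p Φ₀ → IsNewformOf W f →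
      (∀ v ∈ S₀, ((p : ℕ) : 𝓞 ℚ) ∉ v.asIdeal) →
      (∀ v : HeightOneSpectrum (𝓞 ℚ), v ∉ S₀ → ((p : ℕ) : 𝓞 ℚ) ∉ v.asIdeal →
        W.HasGoodReductionAt v) →
      GVAnalyticInput W p κ f S₀ Φ₀ hΦ) :
    lambda_muAnal_multiplicative_of_gvPar := by
  intro W _ _ p _ κ γ N _ f hp hmult hpar hκ hγ hγ' hf D ϖ hϖ fE hchar
  obtain ⟨Φ₀, hΦ, hcase⟩ := hpar
  rcases hcase with ⟨hram, heven⟩ | ⟨hunr, hodd⟩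
  · exact GreenbergVatsalCaseOneLe.caseOne_clause_of_inputs_le hT hT' hB hG hWu hLift hAn W p hp hmult hΦ
      hram heven hκ hγ hγ' hf D ϖ hϖ fE hchar
  · exact caseTwo_clause_of_inputs_le hT hT' hB hG hWu hLift hAn W p hp hmult hΦ hunr hodd hκ hγ hγ' hf D
      ϖ hϖ fE hchar

end Summit.BirchSwinnertonDyer.Rank1Residual.X2.GreenbergVatsalCaseTwoLe

end
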